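import Summits.QuantumFields.YangMills.Theorems.BalabanUVNodesN16Thm4TorusOfHP2PerMember
import Summits.QuantumFields.YangMills.Theorems.BalabanUVNodesN16Thm4ZdPrintOfLeaf

/-!
# Route «BalabanUVNodes», crux K3⁸ `SpineGivenEndpointR13SepCoPHV` (stmt-QuantumFields-27366), node N16 = NE3 — THE MODEL FACE OF THE N05-RECORD-CURRENCY
# SEAM, PRINT-LIST EDITION: Theorem 4 ∧ Proposition 3 of node N05's PERIODIC δ₂-model of record `zdGF3HP₂Per` AT AN ALL-TORUS MEMBER ⟹ node N16's entry
# `Thm4TorusAt L k P η c₁′ (unitaryUnits 𝔸) Reg (Restr129 L k (torusLam k)) Concl_print` with print's (1.36) ∕ (1.38) ∕ (1.39) list, DIRECTLY AT THE PERIOD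

Cell `pub-ymgap`, seat `pub-ymgap-dag-n16-e` (R134 acceleration seat (a), strategy s2; HUMAN RULING D-0062; chair R424 venue), generation 23, companion of
`…N16Thm4TorusOfHP2PerMember` (p676051).  `--kind proof --supports stmt-QuantumFields-27366 --as helper` (count-neutral; proves NO registered stub).
`bears_on: R4∕N16 · edge N05 → N16`.

WHY (gap (g3), Proposition-3 half, of this seat's LOCATED note «N16 ∕ N05 record-currency seam»; plan g87 word (B)).  Node N16's chain entry
`…N16HolderOfThm4Output.n16_holder_of_thm4TorusAt_print` consumes `Thm4TorusAt` with PRINT's conclusion list (`‖A‖`, `‖D^η_{U₀}A‖`, (1.38), the (1.36)₃ Hölder line at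
exponent `β`, `‖Δ^η_{U₀}A‖`), which n16-c's `…N16Thm4ZdPrintOfLeaf.thm4TorusAt_zero_print_of_leaf_member` derives at PERIOD 0 from the Theorem-4 AND Proposition-3 clauses of
n05-a's ORIGINAL ℤᵈ member `zdGF3`.  THIS FILE is its analogue for node N05's periodic δ₂-model of record `B8LeafModelZdHP2Per.zdGF3HP₂Per 𝔸 L β len i P` at a member all-torus
on the levels the two theorems read (`Ω_j = ℤᵈ (j ≤ k)`, `Λs m l = torusLam m l (l ≤ m ≤ k)` — node N16's pinned members, and the κ-cut's `univFam k` member by rigidity),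
DIRECTLY at the period `P` (the periodic model's «exactly one periodic u» is the torus statement).  Model deltas vs `zdGF3`: (1.37) over print's class `towerBondsP` (all level-`k`
bonds here, p676051 §1), (1.66) guarded by `EndBlockIn` (discharged for every bond), (1.36)'s Hölder supremum in the δ₂ class «both end-points in `Ω_j`» (§1's read-out); the
competitor's (1.37) by the (1.42) lemma `B8Eq142KLevelLocal.H42_of_inAx` run on the torus bond family `Λ_b(m, j) = {all bonds} (j = m), ∅ (j ≠ m)`.

WHAT THIS FILE PROVES (kernel; theorems only, 0 `def`, 0 `sorry`):
§1 `grad_pointwise_of_msup_top`, `lap_pointwise_of_bondNorm_top`, `holder_pointwise_of_msup₂_top` — n16-c's pointwise read-outs (`…Thm4ZdPrintReadouts`) with only `Ω_k = ℤᵈ` read,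
   the third in the δ₂ membership.
§2 ★★ `thm4TorusAt_print_of_hp2per_member` — Theorem-4 clause ∧ Proposition-3 clause of `zdGF3HP₂Per 𝔸 L β len i P` at the member, window `hwin` (n16-c's eleven lines) ⟹
   `Thm4TorusAt L i.k (P:ℤ) i.η c₁′ (unitaryUnits 𝔸) Reg (Restr129 L i.k (torusLam i.k)) Concl_print` (n16-c's `Concl_P` + `IsPeriodic P A`).
(§3 — the same read AT NODE N05's WITNESS SLOT OF RECORD, ★★★ `exists_thm4TorusAt_print_of_b8LeafOfRecordSubBP₂DPerκ` — is NOT in this file: it was split, for the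
   400-line rule, to the companion `…N16Thm4TorusOfHP2PerPrintSlot` (p678132); v1.1 docstring erratum after ref-K READ-395 NIT-HEADER (A6); no declaration changed.)

HONEST FRAMING.  Bookkeeping BY NAME; no estimate; Theorem 4 ∕ Proposition 3 at curved backgrounds are node N05's theorems and are HYPOTHESES here (the clauses);
the thresholds stay EXISTENTIAL per slot instance ((g6) of the LOCATED note: uniformity in `P` is NOT supplied by this file); nothing of Bałaban asserted; no stub of K3⁸ closed or
claimed; N16 ∕ N05 NOT discharged; counts UNMOVED (typed 28∕28 · discharged 5∕27 · A 5∕28).  One finite four-torus at fixed `ε`, Bałaban AS PRINTED — NOT ℝ⁴, NOT infinite volume,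
NOT OS, NOT a mass gap; the YM mass gap (Clay) is NOT proved by any of this.
References: [Balaban1985RegularSpaces] T. Bałaban, CMP **99** (1985) 75–102, Thm 4 p. 88, Prop. 3 p. 87, (1.36)–(1.42) pp. 82–83, (1.61)–(1.62) pp. 86–87, (1.66) p. 87, p. 77.
-/

set_option autoImplicit false

open scoped BigOperators
open NormedSpace

namespace Summit.QuantumFields.YangMills.BalabanUVNodes.N16.Thm4TorusOfHP2PerPrint

open Literature.MathematicalPhysics.QuantumFieldTheory.Balaban1983to89
open B7Prop1Explicit B7Prop2Explicit
open B7Prop1Local (InBox loK bondHiK)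
open B7Prop3Flat (c3)
open B7Eq78Linearization (conjR)
open B7Eq92Concrete (mgauge)
open B8Ineq132 (InAk BondTouches covDerivFwd covDeriv norm_conjR_le)
open B8Eq184Proof (cfgExp)
open B8Eq119TwistedAxial (Restr129 InAx)
open B8Eq138LandauZd (IsLandau138 IsLandau138W logCfg covLap covDivB)
open B8Eq140Level (SideTouches)
open B8Eq146AExpansion (iEta)
open B7Prop4GeneralLevels (logCovIter)
open B8Eq155JBound (gradNorm2 gradNorm2_nonneg)
open B8ScaledSupNorm (msup bondNorm weight Bdd bdd_of_forall norm_le_of_msup_le scale_pos)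
open B9Eq340HolderZd (hquot AdmPair trans trans_step hquot_le_of_141)
open B8Thm4TorusAt (torusLam torusLam_self mem_torusLam_iff Cond166T Thm4TorusAt)
open B8Lemma1NonAbelian (mulCfg)
open B8LeafModelZd (ZdIdx)
open B8LeafModelZd3 (mlogCfg)
open B8LeafModelZdPer (isPeriodic_iff_shiftCfg isPeriodic_mgauge isPeriodic_inv)
open B8LeafModelZdHP2Per (zdGF3HP₂Per)
open B8TowerBondsPrinted (towerBondsP)
open B8Prop3GaugeFixedKLevel (eq_mgauge_inv_of_mgauge_eq mem_unitaryUnits_of_mgauge_eq logField_spec mulCfg_eq_gaugeAct_of_mgauge_eq)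
open B8Thm4AtLandau138 (mgauge_mgauge_inv)
open B8Eq142KLevelLocal (H42_of_inAx)
open B8Thm2LogB (blockTop)
open B12Ineq417Flat (shiftCfg shiftCfg_apply)
open T4TermwiseTorus (IsPeriodic)
open Thm4ZdOfLeaf (sideTouches_univ inAx_torusLam_of_le avgIter_mem_unitaryUnits_of_inAk_univ avgClose_of_cond166T sides_of_cond166T)
open Thm4ZdPrintReadouts (bdd_of_norm_le norm_covDerivFwd_le_of_bound norm_covLap_le_of_bound)
open Thm4TorusOfHP2PerMember (inAk_congr_le inAx_congr_le restr129_congr_le isLandau138_congr_le mem_towerBondsP_iff_eq_top mlogCfg_eq_logCfg_of_univ_zero)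

noncomputable section

variable {d : ℕ}

/-! ## §1 Pointwise read-outs of (1.36)₂, (1.39)₂ and the δ₂ (1.36)₃ at a member with `Ω_k = ℤᵈ` -/

section Readouts

variable {𝔸 : Type} [CStarAlgebra 𝔸] [Nontrivial 𝔸]

/-- **(1.36)₂ POINTWISE FROM ITS WEIGHTED SUPREMUM, `Ω_k = ℤᵈ`** (`d ≥ 2`; only the top level is read): `‖(D^η_{U₀,μ}A_κ)(x)‖ ≤ c·(Lᵏη)^{−2}`.
[cite: Balaban1985RegularSpaces, (1.36) p.82, p.86 (definition after (1.55))] -/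
theorem grad_pointwise_of_msup_top (hd2 : 2 ≤ d) {L k : ℕ} (hL : 1 ≤ L) {η : ℝ} (hη : 0 < η) {Ω : ℕ → Set (Site d)}
    (hΩ : Ω k = Set.univ) {U₀ : Site d → Fin d → 𝔸ˣ} (hU₀ : ∀ y κ, U₀ y κ ∈ unitaryUnits 𝔸) {A : Site d → Fin d → 𝔸}
    {a : ℝ} (hA : ∀ y κ, ‖A y κ‖ ≤ a) {c : ℝ}
    (hm : msup L k η (-(2 : ℝ)) (fun j (t : Fin d × Fin d × Site d) => SideTouches (Ω j) t.2.2 t.2.1)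
      (fun t => covDerivFwd η U₀ t.1 (fun z => A z t.2.1) t.2.2) ≤ c) (μ : Fin d) (x : Site d) (κ : Fin d) :
    ‖covDerivFwd η U₀ μ (fun z => A z κ) x‖ ≤ c * ((L : ℝ) ^ k * η) ^ (-(2 : ℝ)) := by
  have hB : Bdd L k η (-(2 : ℝ)) (fun j (t : Fin d × Fin d × Site d) => SideTouches (Ω j) t.2.2 t.2.1)
      (fun t => covDerivFwd η U₀ t.1 (fun z => A z t.2.1) t.2.2) :=
    bdd_of_norm_le hL hη (by norm_num) fun t => norm_covDerivFwd_le_of_bound hη hU₀ (fun y => hA y t.2.1) t.1 t.2.2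
  have hmem : SideTouches (Ω k) x κ := by rw [hΩ]; exact sideTouches_univ hd2 x κ
  exact norm_le_of_msup_le hL hη hB hm (j := k) le_rfl (i := (μ, κ, x)) hmem

/-- **(1.39)₂ POINTWISE FROM ITS BOND NORM, `Ω_k = ℤᵈ`**: `‖(Δ^η_{U₀}A_κ)(x)‖ ≤ c·(Lᵏη)^{−3}`. [cite: Balaban1985RegularSpaces, (1.39) p.83, p.86 (definition after (1.55))] -/
theorem lap_pointwise_of_bondNorm_top {L k : ℕ} (hL : 1 ≤ L) {η : ℝ} (hη : 0 < η) {Ω : ℕ → Set (Site d)} (hΩ : Ω k = Set.univ)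
    {U₀ : Site d → Fin d → 𝔸ˣ} (hU₀ : ∀ y κ, U₀ y κ ∈ unitaryUnits 𝔸) {A : Site d → Fin d → 𝔸} {a : ℝ}
    (hA : ∀ y κ, ‖A y κ‖ ≤ a) {c : ℝ} (hm : bondNorm L k η (-(3 : ℝ)) Ω (fun x μ => covLap η U₀ (fun z => A z μ) x) ≤ c)
    (x : Site d) (κ : Fin d) : ‖covLap η U₀ (fun z => A z κ) x‖ ≤ c * ((L : ℝ) ^ k * η) ^ (-(3 : ℝ)) := by
  have hB : Bdd L k η (-(3 : ℝ)) (fun j (b : Site d × Fin d) => BondTouches (Ω j) b.1 b.2)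
      (fun b => (fun x μ => covLap η U₀ (fun z => A z μ) x) b.1 b.2) :=
    bdd_of_norm_le hL hη (by norm_num) fun b => norm_covLap_le_of_bound hη hU₀ (fun y => hA y b.2) b.1
  have hmem : BondTouches (Ω k) x κ := Or.inl (by rw [hΩ]; exact Set.mem_univ x)
  exact norm_le_of_msup_le hL hη hB hm (j := k) le_rfl (i := (x, κ)) hmem

/-- **THE δ₂ (1.36)₃ AT THE NEAREST-NEIGHBOUR PAIRS FROM ITS WEIGHTED SUPREMUM, `Ω_k = ℤᵈ`** (the [4] (3.40) quotients over the admissible pairs with BOTH end-points in `Ω_j`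
— `zdGF3P₂`'s class; at `Ω_k = ℤᵈ` every admissible pair qualifies): `β ≥ 0`, `len ≥ 1` on its support, `‖A‖ ≤ a(Lᵏη)⁻¹`, `U₀` unitary-valued ⟹ at every admissible pair
`‖R(U₀(y,μ))(D^η_{U₀,μ}A_κ)(y + e_μ) − (D^η_{U₀,μ}A_κ)(y)‖ ≤ c·(Lᵏη)^{−(2+β)}·(η·len e_μ)^β`.  n16-c's `holder_pointwise_of_msup` with the membership predicate changed.
[cite: Balaban1985RegularSpaces, (1.36) p.82; Balaban1985BackgroundPropagators, (3.40) p.397] -/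
theorem holder_pointwise_of_msup₂_top {L k : ℕ} (hL : 1 ≤ L) {η β : ℝ} (hη : 0 < η) (hβ : 0 ≤ β) {len : Site d → ℝ}
    (hlen : ∀ v : Site d, 0 < len v → 1 ≤ len v) {Ω : ℕ → Set (Site d)} (hΩ : Ω k = Set.univ)
    {U₀ : Site d → Fin d → 𝔸ˣ} (hU₀ : ∀ y κ, U₀ y κ ∈ unitaryUnits 𝔸) {A : Site d → Fin d → 𝔸} {a : ℝ}
    (hA : ∀ y κ, ‖A y κ‖ ≤ a * ((L : ℝ) ^ k * η)⁻¹) {c : ℝ}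
    (hm : msup L k η (-(2 + β)) (fun j (q : Fin d × Fin d × (Site d × Site d)) => q.2.2 ∈ AdmPair η len ∧ q.2.2.1 ∈ Ω j ∧ q.2.2.2 ∈ Ω j)
      (fun q => hquot η β len U₀ (covDerivFwd η U₀ q.1 (fun z => A z q.2.1)) q.2.2) ≤ c)
    (μ : Fin d) (y : Site d) (κ : Fin d) (hp : (y, y + e μ) ∈ AdmPair η len) :
    ‖conjR (U₀ y μ) (covDerivFwd η U₀ μ (fun z => A z κ) (y + e μ)) - covDerivFwd η U₀ μ (fun z => A z κ) y‖
      ≤ c * ((L : ℝ) ^ k * η) ^ (-(2 + β)) * (η * len (e μ)) ^ β := by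
  have h1 : ∀ y κ, U₀ y κ ∈ U1 𝔸 := fun y κ => unitaryUnits_le_U1 (hU₀ y κ)
  have hLpos : 0 < L := hL
  have hB : Bdd L k η (-(2 + β)) (fun j (q : Fin d × Fin d × (Site d × Site d)) => q.2.2 ∈ AdmPair η len ∧ q.2.2.1 ∈ Ω j ∧ q.2.2.2 ∈ Ω j)
      (fun q => hquot η β len U₀ (covDerivFwd η U₀ q.1 (fun z => A z q.2.1)) q.2.2) := by
    refine bdd_of_forall (c := ((L : ℝ) ^ k * η) ^ (-(-(2 + β))) *
      (2 * ((((L : ℝ) ^ k * η)⁻¹) ^ 2 * gradNorm2 η L k U₀ A) * (η ^ β)⁻¹)) fun j hj q hq => ?_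
    have hLr : (1 : ℝ) ≤ L := by exact_mod_cast hL
    have hw : weight L η (-(2 + β)) j ≤ ((L : ℝ) ^ k * η) ^ (-(-(2 + β))) := by
      unfold weight
      exact Real.rpow_le_rpow (scale_pos hL hη j).le (mul_le_mul_of_nonneg_right (pow_le_pow_right₀ hLr hj) hη.le) (by linarith)
    have hq0 : 0 ≤ hquot η β len U₀ (covDerivFwd η U₀ q.1 (fun z => A z q.2.1)) q.2.2 :=
      B9Eq340HolderZd.hquot_nonneg hη.le β U₀ _ hq.1
    rw [Real.norm_of_nonneg hq0]
    exact mul_le_mul hw (hquot_le_of_141 hη hβ hlen hLpos k h1 hA q.1 q.2.1 hq.1) hq0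
      (Real.rpow_nonneg (scale_pos hL hη k).le _)
  have hmem : (y, y + e μ) ∈ AdmPair η len ∧ (y, y + e μ).1 ∈ Ω k ∧ (y, y + e μ).2 ∈ Ω k :=
    ⟨hp, by rw [hΩ]; exact Set.mem_univ y, by rw [hΩ]; exact Set.mem_univ _⟩
  have h := norm_le_of_msup_le hL hη hB hm (j := k) le_rfl (i := (μ, κ, (y, y + e μ))) hmem
  have hq0 : 0 ≤ hquot η β len U₀ (covDerivFwd η U₀ μ (fun z => A z κ)) (y, y + e μ) :=
    B9Eq340HolderZd.hquot_nonneg hη.le β U₀ _ hp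
  rw [Real.norm_of_nonneg hq0, B9Eq340HolderZd.hquot_def] at h
  have hv : y + e μ - y = e μ := add_sub_cancel_left y (e μ)
  simp only [hv, trans_step] at h
  have hden : 0 < (η * len (e μ)) ^ β := by
    have hl : 0 < len (e μ) := by have := hp.1; rwa [hv] at this
    exact Real.rpow_pos_of_pos (mul_pos hη hl) β
  rwa [div_le_iff₀ hden] at h

end Readouts

/-! ## §2 The junction with print's (1.36) ∕ (1.38) ∕ (1.39) list at an all-torus member of the periodic δ₂-model, at the period -/

section Member

variable {𝔸 : Type} [CStarAlgebra 𝔸] [Nontrivial 𝔸]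

/-- **★★ THEOREM 4 ∧ PROPOSITION 3 OF NODE N05's PERIODIC δ₂-MODEL AT AN ALL-TORUS MEMBER ⟹ N16's TORUS READING WITH PRINT's CONCLUSION LIST, AT THE PERIOD.**
`d, L ≥ 2`, `P : ℕ`; `i : ZdIdx d L` with `Ω_j = ℤᵈ (j ≤ k)`, `Λs m l = torusLam m l (l ≤ m ≤ k)`; Hölder data `β ≥ 0`, `len ≥ 1` on its support; Theorem-4 constants `c₁`,
`B₁′ > 0`; Proposition-3 threshold `cP` and constants `C₂`, `inp`, `B₀β` with `5dL·inp.B₀ ≤ B₁′`; a threshold `c₁′` placing `(α₀, α₁, α₂ := B₁′(α₀+α₁))` in all windows (`hwin`, n16-c's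
eleven lines VERBATIM).  IF at the member `zdGF3HP₂Per 𝔸 L β len i P` the Theorem-4 clause (`hT`) and the Proposition-3 clause (`hP`) hold, THEN for every `Reg`:
`Thm4TorusAt L i.k P i.η c₁′ (unitaryUnits 𝔸) Reg (Restr129 L i.k (torusLam i.k)) Concl_print` with n16-c's `Concl_P` (`∃ A` self-adjoint, `mgauge U₀ u (cfgExp η A) = U′`,
(1.36)₁ `‖A‖ ≤ Bs(Lᵏη)⁻¹`, (1.36)₂, (1.38) `IsLandau138 L k η univ (torusLam k) U₀ A`, (1.36)₃ Hölder at exponent `β` on `AdmPair`, (1.39)₂; `s = α₀+α₁`, `B = 5dL·inp.B₀`,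
`B_h = 5dL·B₀β`) PLUS `IsPeriodic P A`.  Proof = n16-c's `thm4TorusAt_zero_print_of_leaf_member` with periodicity threaded, the HP letters ((1.37) on `towerBondsP` = all level-`k`
bonds; (1.66)'s `EndBlockIn` guard discharged), the δ₂ Hölder read-out (§1), towers ∕ domains read only `≤ k` (p676051 §1), and the competitor's (1.37) by `H42_of_inAx` on the
torus bond family.
[cite: Balaban1985RegularSpaces, Thm 4 p.88, Prop. 3 p.87, (1.36)–(1.39) pp.82–83, (1.40)–(1.42) p.83, (1.61)–(1.62) pp.86–87, (1.66) p.87, p.77 («Ω_j ⊂ T_η … we admit Ω_j = T_η»)] -/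
theorem thm4TorusAt_print_of_hp2per_member (hd2 : 2 ≤ d) {L : ℕ} (hL : 2 ≤ L) {β : ℝ} (hβ : 0 ≤ β) {len : Site d → ℝ}
    (hlen : ∀ v : Site d, 0 < len v → 1 ≤ len v) (i : ZdIdx d L) (P : ℕ)
    (hΩ : ∀ j, j ≤ i.k → i.Ω j = Set.univ) (hΛs : ∀ m, m ≤ i.k → ∀ l, l ≤ m → i.Λs m l = torusLam m l)
    {c₁ c₁' B₁' cP C₂ B₀β : ℝ} {inp : B8.B9Inputs} (hB₁' : 0 < B₁')
    (hBB : 5 * (d : ℝ) * L * inp.B₀ ≤ B₁')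
    (hwin : ∀ α₀ α₁ : ℝ, 0 < α₀ → 0 < α₁ → α₀ + α₁ ≤ c₁' →
      α₀ + α₁ ≤ c₁ ∧ C0 d * (2 * α₀) ≤ 1 / 3 ∧ 4 * α₀ ≤ c2' d L ∧ 16 * (B₁' * (α₀ + α₁)) ≤ 1 ∧
      Real.exp (4 * (800 * ((d : ℝ) + 1) ^ 2 * ((d : ℝ) + 4)) * α₀) * (1 + 8 * (131072 * ((d : ℝ) + 1) ^ 2) * (B₁' * (α₀ + α₁))) ≤ 2 ∧
      2 * (B₁' * (α₀ + α₁)) ≤ c3 d L ∧ (d : ℝ) * L * α₁ ≤ 1 / 8 ∧ α₀ ≤ cP ∧ α₁ ≤ cP ∧ B₁' * (α₀ + α₁) ≤ cP ∧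
      2 * (B₁' * (α₀ + α₁)) ^ 2 + 20 * d * α₀ * (B₁' * (α₀ + α₁)) + 2 * C₂ * (B₁' * (α₀ + α₁)) ^ 2 ≤ α₀ + α₁)
    (Reg : (Site d → Fin d → 𝔸ˣ) → Prop)
    (hT : ∀ α₀ α₁ : ℝ, 0 < α₀ → 0 < α₁ → α₀ + α₁ ≤ c₁ →
      ∀ (U₀ : (zdGF3HP₂Per 𝔸 L β len i P).Cfg) (Q : (zdGF3HP₂Per 𝔸 L β len i P).Pert),
        (zdGF3HP₂Per 𝔸 L β len i P).InA α₀ U₀ → (zdGF3HP₂Per 𝔸 L β len i P).Reg335 α₀ U₀ → (zdGF3HP₂Per 𝔸 L β len i P).InAAx α₀ U₀ Q →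
        (zdGF3HP₂Per 𝔸 L β len i P).avgClose166 α₁ U₀ Q →
          ∃ u : (zdGF3HP₂Per 𝔸 L β len i P).GT, (zdGF3HP₂Per 𝔸 L β len i P).Restricted U₀ u ∧
            ((zdGF3HP₂Per 𝔸 L β len i P).C137 α₁ U₀ ((zdGF3HP₂Per 𝔸 L β len i P).act Q u) ∧
              (zdGF3HP₂Per 𝔸 L β len i P).Landau U₀ ((zdGF3HP₂Per 𝔸 L β len i P).act Q u) ∧
              (zdGF3HP₂Per 𝔸 L β len i P).C162 B₁' (α₀ + α₁) U₀ ((zdGF3HP₂Per 𝔸 L β len i P).act Q u)) ∧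
            ∀ u' : (zdGF3HP₂Per 𝔸 L β len i P).GT, (zdGF3HP₂Per 𝔸 L β len i P).Restricted U₀ u' →
              (zdGF3HP₂Per 𝔸 L β len i P).C137 α₁ U₀ ((zdGF3HP₂Per 𝔸 L β len i P).act Q u') →
              (zdGF3HP₂Per 𝔸 L β len i P).Landau U₀ ((zdGF3HP₂Per 𝔸 L β len i P).act Q u') →
              (zdGF3HP₂Per 𝔸 L β len i P).C162 B₁' (α₀ + α₁) U₀ ((zdGF3HP₂Per 𝔸 L β len i P).act Q u') → u' = u)
    (hP : ∀ α₀ α₁ α₂ : ℝ, 0 < α₀ → α₀ ≤ cP → 0 < α₁ → α₁ ≤ cP → 0 < α₂ → α₂ ≤ cP →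
      2 * α₂ ^ 2 + 20 * d * α₀ * α₂ + 2 * C₂ * α₂ ^ 2 ≤ α₀ + α₁ →
      ∀ (U₀ : (zdGF3HP₂Per 𝔸 L β len i P).Cfg) (U₁ : (zdGF3HP₂Per 𝔸 L β len i P).Pert),
        (zdGF3HP₂Per 𝔸 L β len i P).InA α₀ U₀ → (zdGF3HP₂Per 𝔸 L β len i P).Reg335 α₀ U₀ → (zdGF3HP₂Per 𝔸 L β len i P).InAPair α₀ U₀ U₁ →
        (zdGF3HP₂Per 𝔸 L β len i P).C162 1 α₂ U₀ U₁ → (zdGF3HP₂Per 𝔸 L β len i P).Landau U₀ U₁ → (zdGF3HP₂Per 𝔸 L β len i P).C137 α₁ U₀ U₁ →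
          (zdGF3HP₂Per 𝔸 L β len i P).C136 (5 * d * (L : ℝ) * inp.B₀) (5 * d * (L : ℝ) * B₀β) (α₀ + α₁) U₀ U₁ ∧
          (zdGF3HP₂Per 𝔸 L β len i P).C139 (5 * d * (L : ℝ) * inp.B₀) (α₀ + α₁) U₀ U₁) :
    Thm4TorusAt L i.k (P : ℤ) i.η c₁' (unitaryUnits 𝔸) Reg (Restr129 L i.k (torusLam i.k))
      (fun (α₀ α₁ : ℝ) (U₀ U' : Site d → Fin d → 𝔸ˣ) (u : Site d → 𝔸ˣ) =>
        ∃ A : Site d → Fin d → 𝔸,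
          (∀ x μ, IsSelfAdjoint (A x μ)) ∧ IsPeriodic P A ∧ mgauge U₀ u (cfgExp i.η A) = U' ∧
          (∀ x μ, ‖A x μ‖ ≤ 5 * (d : ℝ) * L * inp.B₀ * (α₀ + α₁) * ((L : ℝ) ^ i.k * i.η)⁻¹) ∧
          (∀ (μ : Fin d) (x : Site d) (κ : Fin d),
            ‖covDerivFwd i.η U₀ μ (fun z => A z κ) x‖ ≤ 5 * (d : ℝ) * L * inp.B₀ * (α₀ + α₁) * ((L : ℝ) ^ i.k * i.η) ^ (-(2 : ℝ))) ∧
          IsLandau138 L i.k i.η Set.univ (torusLam i.k) U₀ A ∧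
          (∀ (μ : Fin d) (y : Site d) (κ : Fin d), (y, y + e μ) ∈ AdmPair i.η len →
            ‖conjR (U₀ y μ) (covDerivFwd i.η U₀ μ (fun z => A z κ) (y + e μ)) - covDerivFwd i.η U₀ μ (fun z => A z κ) y‖
              ≤ 5 * (d : ℝ) * L * B₀β * (α₀ + α₁) * ((L : ℝ) ^ i.k * i.η) ^ (-(2 + β)) * (i.η * len (e μ)) ^ β) ∧
          (∀ (x : Site d) (κ : Fin d),
            ‖covLap i.η U₀ (fun z => A z κ) x‖ ≤ 5 * (d : ℝ) * L * inp.B₀ * (α₀ + α₁) * ((L : ℝ) ^ i.k * i.η) ^ (-(3 : ℝ)))) := by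
  intro α₀ α₁ hα₀ hα₁ hs U₀ U' hU₀G hU'G hU₀P hU'P hA₀ _ hA hAx h166
  obtain ⟨hs₁, hC0', hα4, h16, hsmall, hc₃, hsmall₁, hα₀P, hα₁P, hα₂P, h61⟩ := hwin α₀ α₁ hα₀ hα₁ hs
  have hL1 : 1 ≤ L := le_trans (by norm_num) hL
  have hL1r : (1 : ℝ) ≤ L := by exact_mod_cast hL1
  have hη := i.hη
  have hB0 : 0 ≤ 5 * (d : ℝ) * L * inp.B₀ := by have := inp.B₀_pos.le; positivity
  -- periodicity of the data
  have hU₀per : IsPeriodic P U₀ := (isPeriodic_iff_shiftCfg U₀).2 hU₀P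
  have hU'per : IsPeriodic P U' := (isPeriodic_iff_shiftCfg U').2 hU'P
  -- the member's sets on the levels read
  have hΩ0 : i.Ω 0 = Set.univ := hΩ 0 (Nat.zero_le _)
  have hΩk : i.Ω i.k = Set.univ := hΩ i.k le_rfl
  have hΛk : ∀ l, l ≤ i.k → i.Λs i.k l = torusLam i.k l := hΛs i.k le_rfl
  have hTB : ∀ j, j ≤ i.k → ∀ c : Site d × Fin d, c ∈ towerBondsP L i.Ω (i.Λs i.k) j ↔ j = i.k :=
    fun j hj c => mem_towerBondsP_iff_eq_top hΩ hΛk hj c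
  have hst : ∀ j, j ≤ i.k → ∀ (y : Site d) (τ : Fin d), SideTouches (i.Ω j) y τ := fun j hj y τ => by
    rw [hΩ j hj]; exact sideTouches_univ hd2 y τ
  have hmlog : ∀ W : Site d → Fin d → 𝔸ˣ, mlogCfg i.k i.η i.Ω W = logCfg i.η W := mlogCfg_eq_logCfg_of_univ_zero hd2 i.k i.η hΩ0
  -- letters
  have hs0 : 0 < α₀ + α₁ := by linarith
  have hα₂ : 0 < B₁' * (α₀ + α₁) := mul_pos hB₁' hs0
  have hLk : (1 : ℝ) ≤ (L : ℝ) ^ i.k := one_le_pow₀ hL1r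
  have hα3 : C0 d * α₀ ≤ 1 / 3 := by nlinarith [C0_pos d]
  have hunit : ∀ j ≤ i.k, ∀ (x : Site d) (κ : Fin d), avgIter L U₀ j x κ ∈ unitaryUnits 𝔸 :=
    avgIter_mem_unitaryUnits_of_inAk_univ hL hα₀ hC0' hα4 hU₀G hA₀
  -- the leaf's data at the member
  let U₀c : (zdGF3HP₂Per 𝔸 L β len i P).Cfg := ⟨U₀, hU₀G, hU₀per⟩
  let Q : (zdGF3HP₂Per 𝔸 L β len i P).Pert := (U₀c, ⟨U', hU'G, hU'per⟩)
  have hInA' : InAk L i.k i.η α₀ i.Ω U₀ := (inAk_congr_le (Ω' := fun _ => Set.univ) hΩ U₀).2 hA₀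
  have hInA : (zdGF3HP₂Per 𝔸 L β len i P).InA α₀ U₀c := hInA'
  have h34 : InAk L i.k i.η α₀ i.Ω (mulCfg U' U₀) := (inAk_congr_le (Ω' := fun _ => Set.univ) hΩ _).2 hA
  have hAx' : ∀ m, m ≤ i.k → InAx L m (i.Λs m) U₀ (mulCfg U' U₀) := fun m hm =>
    (inAx_congr_le (hΛs m hm) U₀ _).2 (inAx_torusLam_of_le hL1 hm hAx)
  have hInAAx : (zdGF3HP₂Per 𝔸 L β len i P).InAAx α₀ U₀c Q := ⟨rfl, h34, hAx'⟩
  have h135 : ∀ j, j ≤ i.k → ∀ (z : Site d) (μ : Fin d), (∀ x, InBox (loK L j z) (bondHiK L j z μ) x → x ∈ i.Ω j) →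
      ‖(avgIter L (mulCfg U' U₀) j z μ : 𝔸) - (avgIter L U₀ j z μ : 𝔸)‖ ≤ α₁ :=
    fun j hj z μ _ => avgClose_of_cond166T h166 hunit j hj z μ
  have h166' : (zdGF3HP₂Per 𝔸 L β len i P).avgClose166 α₁ U₀c Q := by
    refine ⟨fun j hj z μ _ => ?_, fun b _ => ?_⟩
    · show ‖(avgIter L (mulCfg U' U₀) j z μ : 𝔸) - (avgIter L U₀ j z μ : 𝔸)‖ ≤ α₁
      exact avgClose_of_cond166T h166 hunit j hj z μ
    · show ‖((U' b.1 b.2 : 𝔸ˣ) : 𝔸) - 1‖ ≤ α₁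
      exact sides_of_cond166T h166 b.1 b.2
  obtain ⟨u, h129, ⟨h137, hLan, h162⟩, huniq⟩ := hT α₀ α₁ hα₀ hα₁ hs₁ U₀c Q hInA trivial hInAAx h166'
  -- the gauge-fixed field `W = U′^{u⁻¹}`, its logarithm `A`, and Proposition 3 at `α₂ = B₁′(α₀+α₁)`
  have huper : IsPeriodic P u.1 := u.2.2
  have hW : mgauge U₀ u.1 (mgauge U₀ u.1⁻¹ U') = U' := mgauge_mgauge_inv U₀ U' u.1
  have hWper : IsPeriodic P (mgauge U₀ u.1⁻¹ U') := isPeriodic_mgauge hU₀per (isPeriodic_inv huper) hU'per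
  have h162' : ∀ (y : Site d) (τ : Fin d), mgauge U₀ u.1⁻¹ U' y τ = cfgExp i.η (logCfg i.η (mgauge U₀ u.1⁻¹ U')) y τ ∧
      IsSelfAdjoint (logCfg i.η (mgauge U₀ u.1⁻¹ U') y τ) ∧
      ‖logCfg i.η (mgauge U₀ u.1⁻¹ U') y τ‖ ≤ B₁' * (α₀ + α₁) * ((L : ℝ) ^ i.k * i.η)⁻¹ :=
    fun y τ => h162 i.k le_rfl (y, τ) (hst i.k le_rfl y τ)
  have hWexp : mgauge U₀ u.1⁻¹ U' = cfgExp i.η (logCfg i.η (mgauge U₀ u.1⁻¹ U')) := by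
    funext y τ; exact (h162' y τ).1
  have hAper : IsPeriodic P (logCfg i.η (mgauge U₀ u.1⁻¹ U')) := fun x m => by
    funext τ
    simp only [logCfg, congrFun (hWper x m) τ]
  have hui : ∀ x, u.1⁻¹ x ∈ U1 𝔸 := fun x => unitaryUnits_le_U1 ((unitaryUnits 𝔸).inv_mem (u.2.1.1 x))
  have hPair : (zdGF3HP₂Per 𝔸 L β len i P).InAPair α₀ U₀c ((zdGF3HP₂Per 𝔸 L β len i P).act Q u) := by
    show InAk L i.k i.η α₀ i.Ω (mulCfg (mgauge U₀ u.1⁻¹ U') U₀)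
    rw [mulCfg_eq_gaugeAct_of_mgauge_eq hW]
    exact (B8Ineq132.inAk_gaugeAct_iff L i.k i.η α₀ i.Ω hui _).2 h34
  have h162₁ : (zdGF3HP₂Per 𝔸 L β len i P).C162 1 (B₁' * (α₀ + α₁)) U₀c ((zdGF3HP₂Per 𝔸 L β len i P).act Q u) := by
    intro j hj b hb
    have h := h162 j hj b hb
    rwa [one_mul]
  obtain ⟨⟨h36₁, h36₂, h36₃⟩, -, h39₂⟩ :=
    hP α₀ α₁ (B₁' * (α₀ + α₁)) hα₀ hα₀P hα₁ hα₁P hα₂ hα₂P h61 U₀c _ hInA trivial hPair h162₁ hLan h137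
  -- read the output pointwise
  have hsup : ∀ (y : Site d) (τ : Fin d),
      ‖logCfg i.η (mgauge U₀ u.1⁻¹ U') y τ‖ ≤ 5 * (d : ℝ) * L * inp.B₀ * (α₀ + α₁) * ((L : ℝ) ^ i.k * i.η)⁻¹ :=
    fun y τ => (h36₁ i.k le_rfl (y, τ) (hst i.k le_rfl y τ)).2.2
  have hbd : ∀ (y : Site d) (τ : Fin d), ‖logCfg i.η (mgauge U₀ u.1⁻¹ U') y τ‖ ≤ B₁' * (α₀ + α₁) * ((L : ℝ) ^ i.k * i.η)⁻¹ :=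
    fun y τ => (h162' y τ).2.2
  have h36₂' := h36₂
  change msup L i.k i.η (-(2 : ℝ)) (fun j (t : Fin d × Fin d × Site d) => SideTouches (i.Ω j) t.2.2 t.2.1)
      (fun t => covDerivFwd i.η U₀ t.1 (fun z => mlogCfg i.k i.η i.Ω (mgauge U₀ u.1⁻¹ U') z t.2.1) t.2.2)
      ≤ 5 * (d : ℝ) * L * inp.B₀ * (α₀ + α₁) at h36₂'
  have h36₃' := h36₃
  change msup L i.k i.η (-(2 + β))
      (fun j (q : Fin d × Fin d × (Site d × Site d)) => q.2.2 ∈ AdmPair i.η len ∧ q.2.2.1 ∈ i.Ω j ∧ q.2.2.2 ∈ i.Ω j)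
      (fun q => hquot i.η β len U₀ (covDerivFwd i.η U₀ q.1 (fun z => mlogCfg i.k i.η i.Ω (mgauge U₀ u.1⁻¹ U') z q.2.1)) q.2.2)
      ≤ 5 * (d : ℝ) * L * B₀β * (α₀ + α₁) at h36₃'
  have h39₂' := h39₂
  change bondNorm L i.k i.η (-(3 : ℝ)) i.Ω
      (fun x μ => covLap i.η U₀ (fun z => mlogCfg i.k i.η i.Ω (mgauge U₀ u.1⁻¹ U') z μ) x)
      ≤ 5 * (d : ℝ) * L * inp.B₀ * (α₀ + α₁) at h39₂'
  rw [hmlog] at h36₂' h36₃' h39₂'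
  refine ⟨u.1, ⟨u.2.1.1, fun x j => huper x (e j), ?_, logCfg i.η (mgauge U₀ u.1⁻¹ U'),
    fun y τ => (h162' y τ).2.1, hAper, by rw [← hWexp]; exact hW, hsup,
    fun μ x κ => grad_pointwise_of_msup_top hd2 hL1 hη hΩk hU₀G hbd h36₂' μ x κ, ?_,
    fun μ y κ hp => holder_pointwise_of_msup₂_top hL1 hη hβ hlen hΩk hU₀G hbd h36₃' μ y κ hp,
    fun x κ => lap_pointwise_of_bondNorm_top hL1 hη hΩk hU₀G hbd h39₂' x κ⟩, ?_⟩
  · -- (1.29)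
    have h := h129
    change Restr129 L i.k (i.Λs i.k) U₀ u.1 at h
    exact (restr129_congr_le hΛk U₀ u.1).1 h
  · -- (1.38) (the domain is rewritten through a generalisation: `u`'s type mentions `i.Ω 0`)
    have key : ∀ S : Set (Site d), S = Set.univ → IsLandau138 L i.k i.η S (i.Λs i.k) U₀ (logCfg i.η (mgauge U₀ u.1⁻¹ U')) →
        IsLandau138 L i.k i.η Set.univ (torusLam i.k) U₀ (logCfg i.η (mgauge U₀ u.1⁻¹ U')) := by
      rintro S rfl h; exact (isLandau138_congr_le hΛk U₀ _).1 h
    exact key _ hΩ0 hLan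
  · -- uniqueness among ALL periodic unitary gauges with (1.29) and `Concl_print`
    rintro u' hu'G hu'P hRes' ⟨A', hsa', -, hmg', hbd', -, hLan', -, -⟩
    have hu'per : IsPeriodic P u' :=
      (isPeriodic_iff_shiftCfg u').2 fun μ => funext fun x => by rw [shiftCfg_apply]; exact hu'P x μ
    let u'c : (zdGF3HP₂Per 𝔸 L β len i P).GT := ⟨u', ⟨hu'G, fun x hx => absurd (by rw [hΩ0]; exact Set.mem_univ x) hx⟩, hu'per⟩
    have hW'eq : mgauge U₀ u'⁻¹ U' = cfgExp i.η A' := (eq_mgauge_inv_of_mgauge_eq hmg').symm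
    have hW'u : ∀ x κ, cfgExp i.η A' x κ ∈ unitaryUnits 𝔸 := mem_unitaryUnits_of_mgauge_eq hU₀G hU'G hu'G hmg'
    -- `A′` is the logarithm of the competitor's gauge-fixed field
    have ht : 5 * (d : ℝ) * L * inp.B₀ * (α₀ + α₁) * ((L : ℝ) ^ i.k)⁻¹ ≤ 1 / 16 := by
      have h1 : 5 * (d : ℝ) * L * inp.B₀ * (α₀ + α₁) * ((L : ℝ) ^ i.k)⁻¹ ≤ B₁' * (α₀ + α₁) * 1 :=
        mul_le_mul (mul_le_mul_of_nonneg_right hBB hs0.le) (inv_le_one_of_one_le₀ hLk) (by positivity) (by positivity)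
      linarith
    have hbdη : ∀ x κ, ‖A' x κ‖ ≤ 5 * (d : ℝ) * L * inp.B₀ * (α₀ + α₁) * ((L : ℝ) ^ i.k)⁻¹ * i.η⁻¹ := fun x κ => by
      have h := hbd' x κ
      rwa [mul_inv, ← mul_assoc] at h
    have hlog : logCfg i.η (mgauge U₀ u'⁻¹ U') = A' := by
      rw [hW'eq]
      funext x κ
      exact (logField_spec hη U₀ hW'u (rfl : cfgExp i.η A' x κ = cfgExp i.η A' x κ) (hbdη x κ) ht).1
    -- the (1.62) bound with `B₁′` at every level `j ≤ k`
    have hbdj : ∀ j, j ≤ i.k → ∀ (y : Site d) (τ : Fin d), ‖A' y τ‖ ≤ B₁' * (α₀ + α₁) * ((L : ℝ) ^ j * i.η)⁻¹ := by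
      intro j hj y τ
      refine (hbd' y τ).trans ?_
      have hLj : (L : ℝ) ^ j * i.η ≤ (L : ℝ) ^ i.k * i.η :=
        mul_le_mul_of_nonneg_right (pow_le_pow_right₀ hL1r hj) hη.le
      have hLj0 : 0 < (L : ℝ) ^ j * i.η := by positivity
      exact mul_le_mul (mul_le_mul_of_nonneg_right hBB hs0.le) (inv_anti₀ hLj0 hLj) (by positivity) (by positivity)
    have hRes'' : Restr129 L i.k (i.Λs i.k) U₀ u' := (restr129_congr_le hΛk U₀ u').2 hRes'
    have hR' : (zdGF3HP₂Per 𝔸 L β len i P).Restricted U₀c u'c := hRes''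
    -- (1.37) for the competitor by the (1.42) lemma, run on the torus bond family
    have hboxT : ∀ m, m ≤ i.k → ∀ j, j ≤ m → ∀ c ∈ (fun m j => if j = m then (Set.univ : Set (Site d × Fin d)) else ∅) m j,
        ∀ x, InBox (loK L j c.1) (bondHiK L j c.1 c.2) x → x ∈ i.Ω j := by
      intro m hm j hj c _ x _
      rw [hΩ j (hj.trans hm)]; exact Set.mem_univ x
    have hclassT : ∀ m, m ≤ i.k → ∀ j, j ≤ m → ∀ c ∈ (fun m j => if j = m then (Set.univ : Set (Site d × Fin d)) else ∅) m j,
        (c.1 ∈ i.Λs m j ∧ c.1 + e c.2 ∈ i.Λs m j) ∨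
        (∃ j', j = j' + 1 ∧ (∀ x, (L : ℤ) • c.1 ≤ x → x ≤ (L : ℤ) • c.1 + blockTop L → x ∈ i.Λs m j') ∧ c.1 + e c.2 ∈ i.Λs m j) ∨
        (∃ j', j = j' + 1 ∧ c.1 ∈ i.Λs m j ∧ (∀ x, (L : ℤ) • (c.1 + e c.2) ≤ x → x ≤ (L : ℤ) • (c.1 + e c.2) + blockTop L → x ∈ i.Λs m j')) := by
      intro m hm j hj c hc
      by_cases hjm : j = m
      · subst hjm
        left
        rw [hΛs j hm j le_rfl, torusLam_self]
        exact ⟨Set.mem_univ _, Set.mem_univ _⟩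
      · simp only [hjm, if_false, Set.mem_empty_iff_false] at hc
    have h42 := H42_of_inAx hd2 hη hL i.k hU₀G hα₀ hα₁ hα₂.le hα3 hα4 h16 hsmall hc₃ hsmall₁ i.Ω i.hΩ i.Λs
      (fun m j => if j = m then (Set.univ : Set (Site d × Fin d)) else ∅) hboxT hclassT hInA' h34 hAx' h135
      (fun _ _ => True) i.k i.hk le_rfl u' (mgauge U₀ u'⁻¹ U') A' hu'G
      (mgauge_mgauge_inv U₀ U' u') hRes'' trivial hsa'
      (fun j hj y τ _ => ⟨by rw [hW'eq], hbdj j hj y τ⟩)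
      (fun y τ h => absurd (hst 0 (Nat.zero_le _) y τ) (h 0 (Nat.zero_le _)))
    have h137'' : (zdGF3HP₂Per 𝔸 L β len i P).C137 α₁ U₀c ((zdGF3HP₂Per 𝔸 L β len i P).act Q u'c) := by
      show ∀ j, j ≤ i.k → ∀ c ∈ towerBondsP L i.Ω (i.Λs i.k) j,
        ‖logCovIter L U₀ (iEta i.η (mlogCfg i.k i.η i.Ω (mgauge U₀ u'⁻¹ U'))) j c.1 c.2‖ < 2 * d * L * α₁
      intro j hj c hc
      obtain rfl := (hTB j hj c).1 hc
      rw [hmlog, hlog]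
      exact h42 i.k le_rfl c (show c ∈ (if i.k = i.k then (Set.univ : Set (Site d × Fin d)) else ∅) by
        rw [if_pos rfl]; exact Set.mem_univ c)
    have hLan'' : (zdGF3HP₂Per 𝔸 L β len i P).Landau U₀c ((zdGF3HP₂Per 𝔸 L β len i P).act Q u'c) := by
      show IsLandau138 L i.k i.η (i.Ω 0) (i.Λs i.k) U₀ (logCfg i.η (mgauge U₀ u'⁻¹ U'))
      rw [hlog, hΩ0]
      exact (isLandau138_congr_le hΛk U₀ A').2 hLan'
    have h162'' : (zdGF3HP₂Per 𝔸 L β len i P).C162 B₁' (α₀ + α₁) U₀c ((zdGF3HP₂Per 𝔸 L β len i P).act Q u'c) := by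
      show ∀ j, j ≤ i.k → ∀ b ∈ {b : Site d × Fin d | SideTouches (i.Ω j) b.1 b.2},
        mgauge U₀ u'⁻¹ U' b.1 b.2 = cfgExp i.η (logCfg i.η (mgauge U₀ u'⁻¹ U')) b.1 b.2 ∧
          IsSelfAdjoint (logCfg i.η (mgauge U₀ u'⁻¹ U') b.1 b.2) ∧
          ‖logCfg i.η (mgauge U₀ u'⁻¹ U') b.1 b.2‖ ≤ B₁' * (α₀ + α₁) * ((L : ℝ) ^ j * i.η)⁻¹
      intro j hj b _
      rw [hlog, hW'eq]
      exact ⟨rfl, hsa' b.1 b.2, hbdj j hj b.1 b.2⟩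
    have heq := huniq u'c hR' h137'' hLan'' h162''
    exact congrArg Subtype.val heq

end Member

end

end Summit.QuantumFields.YangMills.BalabanUVNodes.N16.Thm4TorusOfHP2PerPrint
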